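import Summits.AtomisticToContinuum.Crystallization.Theorems.PalmUnimodularRigidityMinimiserShellsTwoLevelTransfer
import Summits.AtomisticToContinuum.Crystallization.Theorems.PalmUnimodularRigidityMinimiserShellsExactSplit

/-!
# Crux `MinimiserShells` (stmt-AtomisticToContinuum-9225): monotonicity of the two-level cluster inequality, rung packaging

Route `PalmUnimodularRigidity`, line `exact-elastic-split` (lead c19, 2026-08-17), continuing
`PalmUnimodularRigidityMinimiserShellsTwoLevelTransfer` (p160087) and `…ExactSplit` (p159569).

* `clusterCoerciveAt_mono_coarse` / `clusterCoerciveAt_mono_fine` — `ClusterCoerciveAt θc θf` is monotone in the obvious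
  directions (tightening the coarse level / loosening the fine level only shrinks the priced set and grows the charged set);
* `dyadicRungs_of_clusterFamily` — the strategist's registered stub `stub_clusterCoercivityLoose` (= the family
  `ClusterCoerciveAt (1/20) θ`, `θ ∈ (0, 1/20]`) IMPLIES the dyadic rungs `ClusterCoerciveAt ((1/20)/2^k) ((1/20)/2^(k+1))`:
  the rungs are the WEAKER registered form of the e*-free half (skeleton r2 of the line);
* `dyadicRungs_of_zero_and_tail` — rung `0` is `ClusterCoerciveAt (1/20) (1/40)` and the tail re-indexes from `1/40`;
* `minimiserShells_of_coarseConjecture_rungZero_tail` — **the composition registered for skeleton r2**: the named open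
  core `LennardJonesCoarseShellGapConjecture` (p159569), rung `0` and the tail give the crux (through
  `TwoLevel.minimiserShells_of_coarseGap_and_dyadicRungs`, p160087, and `lennardJonesCoarseShellGapConjecture_iff_shellGap`).
-/

noncomputable section

open MeasureTheory
open scoped ENNReal BigOperators Classical

namespace Summit.AtomisticToContinuum.Crystallization.Theorems.PalmUnimodularRigidityMinimiserShells.TwoLevel

open Literature.MathematicalPhysics.StatisticalMechanics (lennardJones interactionEnergy)
open Summit.AtomisticToContinuum.Crystallization.Theses.PalmUnimodularRigidity (MinimiserShells)
open Summit.AtomisticToContinuum.Crystallization.Theorems.MinimiserShells.Negative.LoadBearing (eStar)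
open Summit.AtomisticToContinuum.Crystallization.Theorems.MinimiserShells.Negative.Rootedness (E3)
open Summit.AtomisticToContinuum.Crystallization.Theorems.PalmUnimodularRigidityMinimiserShells.Residual
  (ShellGap LooseGoodShell looseGoodShell_mono)
open Summit.AtomisticToContinuum.Crystallization
  (LennardJonesCoarseShellGapConjecture lennardJonesCoarseShellGapConjecture_iff_shellGap)

/-! ## Monotonicity of `ClusterCoerciveAt` -/

/-- Counting subtypes of `Fin N` along an implication (real-valued form). -/
theorem natCard_fin_subtype_mono {N : ℕ} {P Q : Fin N → Prop} (h : ∀ i, P i → Q i) :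
    (Nat.card {i : Fin N // P i} : ℝ) ≤ (Nat.card {i : Fin N // Q i} : ℝ) := by
  rw [Nat.card_eq_fintype_card, Nat.card_eq_fintype_card]
  exact_mod_cast Fintype.card_subtype_mono _ _ h

/-- **Tightening the coarse level weakens the cluster inequality**: `ClusterCoerciveAt θc θf → ClusterCoerciveAt θc' θf` for
`0 ≤ θc' ≤ θc ≤ 1/10` — a `θc'`-loosely good `R`-ball is `θc`-loosely good (fewer priced sites), a `θc`-loosely bad site is
`θc'`-loosely bad (more charged sites); same `c, R, C`. -/
theorem clusterCoerciveAt_mono_coarse {θc θc' θf : ℝ} (hc' : 0 ≤ θc') (hcc : θc' ≤ θc) (hc : θc ≤ 1 / 10)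
    (h : ClusterCoerciveAt θc θf) : ClusterCoerciveAt θc' θf := by
  obtain ⟨c, hcpos, H⟩ := h
  refine ⟨c, hcpos, fun ε hε => ?_⟩
  obtain ⟨R, hR, C, hC, H'⟩ := H ε hε
  refine ⟨R, hR, C, hC, fun N y hy hsep => ?_⟩
  have h1 := H' N y hy hsep
  have hA : (Nat.card {i : Fin N //
        ¬ LooseGoodShell θf ((Measure.count : Measure E3).restrict ((fun z => z - y i) '' Set.range y)) ∧
        ∀ j : Fin N, dist (y i) (y j) ≤ R →
          LooseGoodShell θc' ((Measure.count : Measure E3).restrict ((fun z => z - y j) '' Set.range y))} : ℝ) ≤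
      (Nat.card {i : Fin N //
        ¬ LooseGoodShell θf ((Measure.count : Measure E3).restrict ((fun z => z - y i) '' Set.range y)) ∧
        ∀ j : Fin N, dist (y i) (y j) ≤ R →
          LooseGoodShell θc ((Measure.count : Measure E3).restrict ((fun z => z - y j) '' Set.range y))} : ℝ) :=
    natCard_fin_subtype_mono fun i hi => ⟨hi.1, fun j hj => looseGoodShell_mono hc' hcc hc (hi.2 j hj)⟩
  have hB : (Nat.card {j : Fin N //
        ¬ LooseGoodShell θc ((Measure.count : Measure E3).restrict ((fun z => z - y j) '' Set.range y))} : ℝ) ≤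
      (Nat.card {j : Fin N //
        ¬ LooseGoodShell θc' ((Measure.count : Measure E3).restrict ((fun z => z - y j) '' Set.range y))} : ℝ) :=
    natCard_fin_subtype_mono fun j hj hgood => hj (looseGoodShell_mono hc' hcc hc hgood)
  have h2 := mul_le_mul_of_nonneg_left hA hcpos.le
  have h3 := mul_le_mul_of_nonneg_left hB hC
  linarith

/-- **Loosening the fine level weakens the cluster inequality**: `ClusterCoerciveAt θc θf → ClusterCoerciveAt θc θf'` for
`0 ≤ θf ≤ θf' ≤ 1/10` — a `θf'`-loosely bad site is `θf`-loosely bad (fewer priced sites); same `c, R, C`. -/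
theorem clusterCoerciveAt_mono_fine {θc θf θf' : ℝ} (hf : 0 ≤ θf) (hff : θf ≤ θf') (hf' : θf' ≤ 1 / 10)
    (h : ClusterCoerciveAt θc θf) : ClusterCoerciveAt θc θf' := by
  obtain ⟨c, hcpos, H⟩ := h
  refine ⟨c, hcpos, fun ε hε => ?_⟩
  obtain ⟨R, hR, C, hC, H'⟩ := H ε hε
  refine ⟨R, hR, C, hC, fun N y hy hsep => ?_⟩
  have h1 := H' N y hy hsep
  have hA : (Nat.card {i : Fin N //
        ¬ LooseGoodShell θf' ((Measure.count : Measure E3).restrict ((fun z => z - y i) '' Set.range y)) ∧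
        ∀ j : Fin N, dist (y i) (y j) ≤ R →
          LooseGoodShell θc ((Measure.count : Measure E3).restrict ((fun z => z - y j) '' Set.range y))} : ℝ) ≤
      (Nat.card {i : Fin N //
        ¬ LooseGoodShell θf ((Measure.count : Measure E3).restrict ((fun z => z - y i) '' Set.range y)) ∧
        ∀ j : Fin N, dist (y i) (y j) ≤ R →
          LooseGoodShell θc ((Measure.count : Measure E3).restrict ((fun z => z - y j) '' Set.range y))} : ℝ) :=
    natCard_fin_subtype_mono fun i hi => ⟨fun hgood => hi.1 (looseGoodShell_mono hf hff hf' hgood), hi.2⟩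
  have h2 := mul_le_mul_of_nonneg_left hA hcpos.le
  linarith

/-! ## Rung packaging -/

/-- The dyadic levels are at most `1/20`. -/
theorem dyadicLevel_le (k : ℕ) : (1 / 20 : ℝ) / 2 ^ k ≤ 1 / 20 :=
  div_le_self (by norm_num) (one_le_pow₀ (by norm_num))

/-- The dyadic levels are positive. -/
theorem dyadicLevel_pos (k : ℕ) : 0 < (1 / 20 : ℝ) / 2 ^ k := by positivity

/-- One dyadic step: `(1/20)/2^(k+1) = ((1/20)/2^k)/2`, and it is below `(1/20)/2^k`. -/
theorem dyadicLevel_succ_le (k : ℕ) : (1 / 20 : ℝ) / 2 ^ (k + 1) ≤ (1 / 20 : ℝ) / 2 ^ k := by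
  rw [pow_succ]
  exact div_le_div_of_nonneg_left (by norm_num) (by positivity) (le_mul_of_one_le_right (by positivity) (by norm_num))

/-- Re-indexing the tail: `(1/20)/2^(k+1) = (1/40)/2^k`. -/
theorem dyadicLevel_succ_eq (k : ℕ) : (1 / 20 : ℝ) / 2 ^ (k + 1) = (1 / 40 : ℝ) / 2 ^ k := by
  rw [pow_succ]; ring

/-- **The level-`1/20` cluster family (the strategist's registered stub `stub_clusterCoercivityLoose`) implies the dyadic
rungs** — the rungs are the WEAKER form: rung `k` is the family member at `θ = (1/20)/2^(k+1)` with the coarse level tightened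
from `1/20` to `(1/20)/2^k` (`clusterCoerciveAt_mono_coarse`). -/
theorem dyadicRungs_of_clusterFamily (h : ∀ θ : ℝ, 0 < θ → θ ≤ 1 / 20 → ClusterCoerciveAt (1 / 20) θ) :
    ∀ k : ℕ, ClusterCoerciveAt ((1 / 20 : ℝ) / 2 ^ k) ((1 / 20 : ℝ) / 2 ^ (k + 1)) := fun k =>
  clusterCoerciveAt_mono_coarse (dyadicLevel_pos k).le (dyadicLevel_le k) (by norm_num)
    (h _ (dyadicLevel_pos (k + 1)) (dyadicLevel_le (k + 1)))

/-- **Rung `0` + the re-indexed tail = all dyadic rungs.**  Rung `0` is `ClusterCoerciveAt (1/20) (1/40)`; the tail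
`ClusterCoerciveAt ((1/40)/2^k) ((1/40)/2^(k+1))`, `k : ℕ`, is rungs `1, 2, …`. -/
theorem dyadicRungs_of_zero_and_tail (h0 : ClusterCoerciveAt (1 / 20) (1 / 40))
    (htail : ∀ k : ℕ, ClusterCoerciveAt ((1 / 40 : ℝ) / 2 ^ k) ((1 / 40 : ℝ) / 2 ^ (k + 1))) :
    ∀ k : ℕ, ClusterCoerciveAt ((1 / 20 : ℝ) / 2 ^ k) ((1 / 20 : ℝ) / 2 ^ (k + 1)) := by
  intro k
  cases k with
  | zero =>
    have e1 : (1 / 20 : ℝ) / 2 ^ 0 = 1 / 20 := by norm_num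
    have e2 : (1 / 20 : ℝ) / 2 ^ (0 + 1) = 1 / 40 := by norm_num
    rw [e1, e2]
    exact h0
  | succ k => rw [dyadicLevel_succ_eq, dyadicLevel_succ_eq]; exact htail k

/-- Conversely all dyadic rungs give rung `0` and the tail (so the r2 registration loses nothing against r1's). -/
theorem zero_and_tail_of_dyadicRungs (h : ∀ k : ℕ, ClusterCoerciveAt ((1 / 20 : ℝ) / 2 ^ k) ((1 / 20 : ℝ) / 2 ^ (k + 1))) :
    ClusterCoerciveAt (1 / 20) (1 / 40) ∧
      ∀ k : ℕ, ClusterCoerciveAt ((1 / 40 : ℝ) / 2 ^ k) ((1 / 40 : ℝ) / 2 ^ (k + 1)) := by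
  have e1 : (1 / 20 : ℝ) / 2 ^ 0 = 1 / 20 := by norm_num
  have e2 : (1 / 20 : ℝ) / 2 ^ (0 + 1) = 1 / 40 := by norm_num
  refine ⟨?_, fun k => ?_⟩
  · have h0 := h 0
    rw [e1, e2] at h0
    exact h0
  · rw [← dyadicLevel_succ_eq, ← dyadicLevel_succ_eq]
    exact h (k + 1)

/-! ## The composition registered for skeleton r2 -/

/-- **Skeleton r2 of line `exact-elastic-split`, composed (registered on stmt-AtomisticToContinuum-9225):** the named open core
`LennardJonesCoarseShellGapConjecture` (= `ShellGap (1/20)`, p159569; OPEN PROBLEM, Blanc–Lewin 2015 §2.3), rung `0`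
`ClusterCoerciveAt (1/20) (1/40)` and the tail rungs `ClusterCoerciveAt ((1/40)/2^k) ((1/40)/2^(k+1))` (e*-free finite-cluster
statements) give the crux `MinimiserShells` — via `dyadicRungs_of_zero_and_tail` and `minimiserShells_of_coarseGap_and_dyadicRungs` (p160087). -/
theorem minimiserShells_of_coarseConjecture_rungZero_tail : LennardJonesCoarseShellGapConjecture → ClusterCoerciveAt (1 / 20) (1 / 40) → (∀ k : ℕ, ClusterCoerciveAt ((1 / 40 : ℝ) / 2 ^ k) ((1 / 40 : ℝ) / 2 ^ (k + 1))) → MinimiserShells :=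
  fun h₁ h0 htail => minimiserShells_of_coarseGap_and_dyadicRungs (lennardJonesCoarseShellGapConjecture_iff_shellGap.1 h₁)
    (dyadicRungs_of_zero_and_tail h0 htail)

/-- The same composition fed by the level-`1/20` family (r1's registered stub 2) instead of the rungs. -/
theorem minimiserShells_of_coarseConjecture_clusterFamily (h₁ : LennardJonesCoarseShellGapConjecture)
    (h₂ : ∀ θ : ℝ, 0 < θ → θ ≤ 1 / 20 → ClusterCoerciveAt (1 / 20) θ) : MinimiserShells :=
  minimiserShells_of_coarseGap_and_dyadicRungs (lennardJonesCoarseShellGapConjecture_iff_shellGap.1 h₁)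
    (dyadicRungs_of_clusterFamily h₂)

end Summit.AtomisticToContinuum.Crystallization.Theorems.PalmUnimodularRigidityMinimiserShells.TwoLevel

end
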